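import Summits.PneNP.PneNP.Theses.SymmetryBudget

/-!
# PneNP / SymmetryBudget — assembly item `Assembly` (stmt-PneNP-10638)

Route `PneNP/SymmetryBudget`, assembly item stmt-PneNP-10638 (rank 1):

  `WindowHam → HamCompiles → PneNP`

with the two hypotheses written inline (syntactically identical to the route decls
`WindowHam` and `HamCompiles`).  Pure logic, no Literature fact: assume `¬ PneNP`, i.e. every
`L ∈ PNPWave0.NP Bool` lies in `PNPWave0.P Bool`, so `NP Bool ⊆ P Bool`; the second hypothesis
(`HamCompiles`) yields a polynomial `p` with `Bud(m,⌊log₂ m⌋)`-symmetric threshold circuits of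
size `≤ p(m)` for `x ↦ [Gr(x).IsHamiltonian]` at EVERY `m`, contradicting the first hypothesis
(`WindowHam`) at `p` (`∃ᶠ m, ¬ HasSym …` gives such an `m`).  The two inline `let` vocabularies
are syntactically identical, so the contradiction is literal (definitional).  This is the same
argument as the route's deciding theorem `Summit.PneNP.PneNP.Theses.SymmetryBudget.closes`,
reproved here self-containedly so that the closing theorem does not depend on it.

References: S. Cook, *The P versus NP problem*, Clay Mathematics Institute (2006), §1
[CookClay2006].
-/

-- `Summit.PneNP.PneNP.…` duplicates `PneNP` BY DESIGN (single-problem summit, D-0017); the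
-- Summits library sets this option globally (lakefile); repeated here so that a standalone
-- `lean check` is warning-free.
set_option linter.dupNamespace false

namespace Summit.PneNP.PneNP.Theorems

/-- **Assembly of route `PneNP/SymmetryBudget`** (item stmt-PneNP-10638, literally the route
decl `Summit.PneNP.PneNP.Theses.SymmetryBudget.Assembly`): `WindowHam → HamCompiles → PneNP`
with both hypotheses inline.  Proof: if `¬ PneNP` then `PNPWave0.NP Bool ⊆ PNPWave0.P Bool`;
the compilation hypothesis gives a polynomial size bound `p` valid at every `m`; the window
lower bound at `p` gives (frequently, hence at least once) an `m` with no such circuit —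
contradiction (Cook's Clay formulation of `P ≠ NP`, CookClay2006 §1). [folklore] -/
theorem assembly_proof : Summit.PneNP.PneNP.Theses.SymmetryBudget.Assembly := by
  unfold Summit.PneNP.PneNP.Theses.SymmetryBudget.Assembly
  intro h₁ h₂
  by_contra hne
  have hsub : Literature.Computability.Complexity.PNPWave0.NP Bool ⊆
      Literature.Computability.Complexity.PNPWave0.P Bool :=
    fun L hL => by_contra fun hL' => hne ⟨L, hL, hL'⟩
  obtain ⟨p, hp⟩ := h₂ hsub
  obtain ⟨m, hm⟩ := (h₁ p).exists
  exact hm (hp m)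

end Summit.PneNP.PneNP.Theorems
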